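import Literature.Probability.RandomPlanarGeometry.SLE
import HarnessLib

/-!
# Hulls of the upper half-plane and the restriction formula for SLE_{8/3} (Lawler–Schramm–Werner 2003)

The half-plane vocabulary of

* G. F. Lawler, O. Schramm, W. Werner, *Conformal restriction: the chordal case*, J. Amer. Math.
  Soc. **16** (2003) 917–955, arXiv:math/0209343 (**[LSW]**, arXiv page numbers), §2 (pp. 7–9),

in which the paper's theorems are printed, and its central theorem, **Thm. 6.1** (p. 23, the
restriction formula for SLE_{8/3}), as a named fact stated VERBATIM in that vocabulary. This is
level 1 of the decomposition of the named fact `Literature.Probability.RandomPlanarGeometry.LawlerSchrammWerner2003` (file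
`ConformalRestriction`; level 0, the transposition to Dobrushin domains and the assembly, is
`ConformalRestrictionProofs`): the transposed fact `Literature.Probability.RandomPlanarGeometry.IsSLELaw.hullRestriction_eightThirds`
there is Thm. 6.1 below carried through a chordal uniformizing map.

* `Literature.IsBoundedHull A` — [LSW] `𝒬`: "the set of all bounded `A ⊂ ℍ̄` such that `A = cl(A ∩ ℍ)`
  and `ℍ ∖ A` is (connected and) simply connected. We call such an `A` a bounded hull."
* `Literature.IsStarHull A` — [LSW] `𝒬*`: "the set of `A ∈ 𝒬` with `0 ∉ A`."
* `Literature.IsPlusHull A`, `Literature.IsMinusHull A` — [LSW] `𝒬₊`, `𝒬₋`: `A ∈ 𝒬*` with `A ∩ ℝ ⊂ (0, ∞)`,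
  resp. `⊂ (−∞, 0)`.
* `Literature.IsRestrictionMap A Φ` — [LSW] `Φ_A`: "the unique conformal transformation `Φ` of `ℍ ∖ A`
  onto `ℍ` fixing `0` and `∞` with `Φ(z)/z → 1` as `z → ∞`" (as a PREDICATE on conformal
  equivalences `ℍ ∖ A → ℍ`; existence and uniqueness, which rest on the Riemann mapping theorem,
  are the named fact `Literature.Probability.RandomPlanarGeometry.IsStarHull.existsUnique_isRestrictionMap`).
* `Literature.HasRestrictionDeriv A Φ d` — the number `Φ'_A(0)`, introduced as the limit `d` of
  `Φ(z)/z` as `z → 0` inside `ℍ ∖ A` (`Φ_A` fixes `0` and extends analytically across `ℝ` near `0`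
  by Schwarz reflection, so this limit is its derivative there; existence and `0 < Φ'_A(0) ≤ 1`,
  [LSW] (2.4), are the named fact `Literature.Probability.RandomPlanarGeometry.IsStarHull.exists_hasRestrictionDeriv`).
* `Literature.Probability.RandomPlanarGeometry.sle_restriction_eightThirds` — NAMED FACT, [LSW] Thm. 6.1: for the SLE_{8/3} path `γ`
  from `0` in `ℍ` and `A ∈ 𝒬*`, `P[γ[0, ∞) ∩ A = ∅] = Φ'_A(0)^{5/8}`.

Proved API (non-vacuity): the empty set is a hull of every kind, the identity is its restriction
map (`ConformalEquiv.copy` transports `ConformalEquiv.refl ℍ` to the type `ℍ ∖ ∅ → ℍ`) with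
`Φ'_∅(0) = 1`, so that Thm. 6.1 at `A = ∅` reads `P[Ω] = 1`
(`sle_restriction_eightThirds.measure_univ`).

Not vendored here (level 2): the half-plane capacity `a(A)` and `g_A` ((2.1)–(2.3)), smooth hulls
and Lemma 2.1, the space `Ω` of Def. 3.1 with its σ-algebra, Lemma 3.2, Prop. 3.3 / Def. 3.4
(`P_α`), Prop. 5.2, Thm. 7.3, §8.

Mathlib: `IsSimplyConnected` (a subset whose subtype is a simply connected space),
`Bornology.IsBounded`, `Filter.cocompact`; the tree's `Literature.Probability.RandomPlanarGeometry.ConformalEquiv` (with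
`HasBoundaryValue`), `Literature.Probability.RandomPlanarGeometry.sleTrace`, `Literature.Probability.Process.preWienerMeasure`.
-/

noncomputable section

open Set Filter Topology MeasureTheory
open UpperHalfPlane (upperHalfPlaneSet isOpen_upperHalfPlaneSet)
open scoped NNReal

namespace Literature.Probability.RandomPlanarGeometry

/-! ### Transport of a conformal equivalence along equalities of sets -/

namespace ConformalEquiv

variable {U V U' V' : Set ℂ}

/-- Transport a conformal equivalence `U → V` along set equalities `U' = U`, `V' = V` (same
underlying partial equivalence). Used to view the identity of `ℍₒ` as a map `ℍₒ ∖ ∅ → ℍₒ`. [folklore] -/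
def copy (φ : ConformalEquiv U V) (U' V' : Set ℂ) (hU : U' = U) (hV : V' = V) :
    ConformalEquiv U' V' where
  toPartialEquiv := φ.toPartialEquiv
  source_eq := φ.source_eq.trans hU.symm
  target_eq := φ.target_eq.trans hV.symm
  differentiableOn := hU ▸ φ.differentiableOn
  differentiableOn_symm := hV ▸ φ.differentiableOn_symm

/-- `copy` does not change the map. [folklore] -/
@[simp] theorem copy_apply (φ : ConformalEquiv U V) (U' V' : Set ℂ) (hU : U' = U) (hV : V' = V)
    (z : ℂ) : φ.copy U' V' hU hV z = φ z := rfl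

end ConformalEquiv

/-! ### Hulls ([LSW] §2, pp. 7–8) -/

/-- **Bounded hull** (`A ∈ 𝒬`, [LSW] §2 p. 7): a bounded `A ⊆ ℂ` with `A = closure (A ∩ ℍₒ)` (so
`A ⊆ ℍ̄ₒ` is compact and is the closure of its part in the open half-plane) such that `ℍₒ ∖ A` is
(nonempty, connected and) simply connected. [cite: LawlerSchrammWerner2003Restriction, §2 p. 7 (bounded hulls 𝒬)] -/
def IsBoundedHull (A : Set ℂ) : Prop :=
  Bornology.IsBounded A ∧ closure (A ∩ upperHalfPlaneSet) = A ∧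
    IsSimplyConnected (upperHalfPlaneSet \ A)

/-- **`*`-hull** (`A ∈ 𝒬*`, [LSW] §2 p. 8): a bounded hull not containing the origin, so that
`ℍₒ ∖ A` is "a simply connected subdomain `H ⊆ ℍ` with `ℍ ∖ H` bounded and bounded away from
`0`" as in [LSW] §1. [cite: LawlerSchrammWerner2003Restriction, §2 p. 8 (*-hulls 𝒬*)] -/
def IsStarHull (A : Set ℂ) : Prop :=
  IsBoundedHull A ∧ (0 : ℂ) ∉ A

/-- **`+`-hull** (`A ∈ 𝒬₊`, [LSW] §2 p. 8): a `*`-hull whose real points are positive,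
`A ∩ ℝ ⊆ (0, ∞)`. [cite: LawlerSchrammWerner2003Restriction, §2 p. 8 (±-hulls)] -/
def IsPlusHull (A : Set ℂ) : Prop :=
  IsStarHull A ∧ ∀ x : ℝ, (x : ℂ) ∈ A → 0 < x

/-- **`−`-hull** (`A ∈ 𝒬₋ = σ(𝒬₊)`, [LSW] §2 p. 8): a `*`-hull whose real points are negative,
`A ∩ ℝ ⊆ (−∞, 0)`. [cite: LawlerSchrammWerner2003Restriction, §2 p. 8 (±-hulls)] -/
def IsMinusHull (A : Set ℂ) : Prop :=
  IsStarHull A ∧ ∀ x : ℝ, (x : ℂ) ∈ A → x < 0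

/-- A bounded hull is the closure of its part in `ℍₒ`. [folklore] -/
theorem IsBoundedHull.closure_inter_eq {A : Set ℂ} (h : IsBoundedHull A) :
    closure (A ∩ upperHalfPlaneSet) = A :=
  h.2.1

/-- A bounded hull is closed. [folklore] -/
theorem IsBoundedHull.isClosed {A : Set ℂ} (h : IsBoundedHull A) : IsClosed A := by
  rw [← h.closure_inter_eq]
  exact isClosed_closure

/-- A bounded hull is compact. [folklore] -/
theorem IsBoundedHull.isCompact {A : Set ℂ} (h : IsBoundedHull A) : IsCompact A :=
  Metric.isCompact_of_isClosed_isBounded h.isClosed h.1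

/-- A bounded hull lies in the closed upper half-plane. [folklore] -/
theorem IsBoundedHull.subset_closure {A : Set ℂ} (h : IsBoundedHull A) :
    A ⊆ closure upperHalfPlaneSet := by
  rw [← h.closure_inter_eq]
  exact closure_mono inter_subset_right

/-- A `*`-hull is a bounded hull. [folklore] -/
theorem IsStarHull.isBoundedHull {A : Set ℂ} (h : IsStarHull A) : IsBoundedHull A :=
  h.1

/-- The origin is not in a `*`-hull. [folklore] -/
theorem IsStarHull.zero_notMem {A : Set ℂ} (h : IsStarHull A) : (0 : ℂ) ∉ A :=
  h.2

/-- For a `*`-hull, the origin is a boundary point of `ℍₒ ∖ A` (it lies in its closure), so that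
"`Φ_A` fixes `0`" is a statement about boundary values. [folklore] -/
theorem IsStarHull.zero_mem_closure_diff {A : Set ℂ} (h : IsStarHull A) :
    (0 : ℂ) ∈ closure (upperHalfPlaneSet \ A) := by
  -- points `I * t`, `t ↓ 0`, lie in `ℍₒ` and eventually outside the closed set `A ∌ 0`
  have hA : Aᶜ ∈ 𝓝 (0 : ℂ) := h.1.isClosed.isOpen_compl.mem_nhds h.2
  have hpath : Tendsto (fun t : ℝ ↦ (Complex.I * t : ℂ)) (𝓝[>] 0) (𝓝 0) := by
    have : Continuous fun t : ℝ ↦ (Complex.I * t : ℂ) := by fun_prop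
    simpa using (this.tendsto 0).mono_left nhdsWithin_le_nhds
  refine mem_closure_of_tendsto hpath ?_
  filter_upwards [hpath.eventually hA, self_mem_nhdsWithin] with t htA ht
  refine ⟨?_, htA⟩
  show 0 < (Complex.I * t : ℂ).im
  simpa using ht

/-- The empty set is a bounded hull (`ℍₒ ∖ ∅ = ℍₒ` is simply connected). [folklore] -/
theorem isBoundedHull_empty : IsBoundedHull (∅ : Set ℂ) := by
  refine ⟨Bornology.isBounded_empty, by simp, ?_⟩
  rw [sdiff_empty]
  exact isSimplyConnected_upperHalfPlaneSet

/-- The empty set is a `*`-hull. [folklore] -/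
theorem isStarHull_empty : IsStarHull (∅ : Set ℂ) :=
  ⟨isBoundedHull_empty, notMem_empty _⟩

/-- The empty set is a `+`-hull. [folklore] -/
theorem isPlusHull_empty : IsPlusHull (∅ : Set ℂ) :=
  ⟨isStarHull_empty, fun _ h ↦ absurd h (notMem_empty _)⟩

/-- The empty set is a `−`-hull. [folklore] -/
theorem isMinusHull_empty : IsMinusHull (∅ : Set ℂ) :=
  ⟨isStarHull_empty, fun _ h ↦ absurd h (notMem_empty _)⟩

/-! ### The normalized maps `Φ_A` and the numbers `Φ'_A(0)` -/

/-- **The normalized conformal map `Φ_A`** ([LSW] §2 p. 8), as a predicate: `Φ : ℍₒ ∖ A → ℍₒ` is a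
conformal equivalence which fixes `0` (boundary value `0` at the boundary point `0`) and `∞` with
`Φ(z)/z → 1` as `z → ∞` inside `ℍₒ ∖ A` ("`Φ_A(z) = g_A(z) − g_A(0)`, the unique conformal
transformation `Φ` of `ℍ ∖ A` onto `ℍ` fixing `0` and `∞` with `Φ(z)/z → 1` as `z → ∞`").
[cite: LawlerSchrammWerner2003Restriction, §2 p. 8 (the normalized conformal maps Φ_A)] -/
def IsRestrictionMap (A : Set ℂ)
    (Φ : ConformalEquiv (upperHalfPlaneSet \ A) upperHalfPlaneSet) : Prop :=
  Φ.HasBoundaryValue 0 0 ∧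
    Tendsto (fun z ↦ Φ z / z) (cocompact ℂ ⊓ 𝓟 (upperHalfPlaneSet \ A)) (𝓝 1)

/-- **The number `Φ'_A(0)`** as a predicate: `d` is the limit of `Φ(z)/z` as `z → 0` inside
`ℍₒ ∖ A`. For the map `Φ_A` of a `*`-hull (`Φ_A(0) = 0`; `Φ_A` extends analytically to a
neighbourhood of `0` by Schwarz reflection, [LSW] proof of Lemma 3.5, p. 12) this limit exists and
is the derivative `Φ'_A(0) ∈ (0, 1]` ([LSW] (2.4), p. 7). [cite: LawlerSchrammWerner2003Restriction, §2 p. 8 (Φ_A) with (2.4) p. 7] -/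
def HasRestrictionDeriv (A : Set ℂ) (Φ : ConformalEquiv (upperHalfPlaneSet \ A) upperHalfPlaneSet)
    (d : ℝ) : Prop :=
  Tendsto (fun z ↦ Φ z / z) (𝓝[upperHalfPlaneSet \ A] 0) (𝓝 (d : ℂ))

/-- The number `Φ'_A(0)` is unique (limits within `ℍₒ ∖ A` at the boundary point `0` are unique,
`0` being in the closure). [folklore] -/
theorem HasRestrictionDeriv.unique {A : Set ℂ} (hA : IsStarHull A)
    {Φ : ConformalEquiv (upperHalfPlaneSet \ A) upperHalfPlaneSet} {d d' : ℝ}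
    (h : HasRestrictionDeriv A Φ d) (h' : HasRestrictionDeriv A Φ d') : d = d' := by
  haveI : (𝓝[upperHalfPlaneSet \ A] (0 : ℂ)).NeBot :=
    mem_closure_iff_nhdsWithin_neBot.1 hA.zero_mem_closure_diff
  exact_mod_cast tendsto_nhds_unique h h'

/-- The identity of `ℍₒ`, viewed as a conformal equivalence `ℍₒ ∖ ∅ → ℍₒ`. [folklore] -/
def restrictionMapEmpty : ConformalEquiv (upperHalfPlaneSet \ ∅) upperHalfPlaneSet :=
  (ConformalEquiv.refl upperHalfPlaneSet).copy _ _ sdiff_empty rfl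

/-- The identity is the map `Φ_∅`. [folklore] -/
@[simp] theorem restrictionMapEmpty_apply (z : ℂ) : restrictionMapEmpty z = z := rfl

/-- `Φ_∅ = id` is a restriction map of the empty hull. [folklore] -/
theorem isRestrictionMap_empty : IsRestrictionMap ∅ restrictionMapEmpty := by
  refine ⟨?_, ?_⟩
  · change Tendsto (fun z : ℂ ↦ restrictionMapEmpty z) _ _
    simp only [restrictionMapEmpty_apply]
    exact tendsto_id.mono_left nhdsWithin_le_nhds
  · simp only [restrictionMapEmpty_apply]
    have h : {z : ℂ | z ≠ 0} ∈ cocompact ℂ ⊓ 𝓟 (upperHalfPlaneSet \ ∅) :=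
      mem_inf_of_left (isCompact_singleton (x := (0 : ℂ))).compl_mem_cocompact
    refine (tendsto_const_nhds (x := (1 : ℂ))).congr' ?_
    filter_upwards [h] with z hz
    rw [div_self hz]

/-- `Φ'_∅(0) = 1`. [folklore] -/
theorem hasRestrictionDeriv_empty : HasRestrictionDeriv ∅ restrictionMapEmpty 1 := by
  unfold HasRestrictionDeriv
  simp only [restrictionMapEmpty_apply]
  refine (tendsto_const_nhds (x := ((1 : ℝ) : ℂ))).congr' ?_
  filter_upwards [self_mem_nhdsWithin] with z hz
  have hz0 : z ≠ 0 := by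
    rintro rfl
    exact absurd hz.1 (by simp [upperHalfPlaneSet])
  rw [Complex.ofReal_one, div_self hz0]

/-- NAMED FACT — **existence and uniqueness of `Φ_A`** ([LSW] §2 pp. 7–8: "there is a unique conformal
transformation `g_A : ℍ ∖ A → ℍ` with `g_A(z) − z → 0` as `z → ∞`", whence `Φ_A = g_A − g_A(0)`;
Riemann mapping theorem with the hydrodynamic normalization at `∞`). Uniqueness is stated as
`EqOn` on `ℍₒ ∖ A` (a `ConformalEquiv` carries junk values elsewhere).
[cite: LawlerSchrammWerner2003Restriction, §2 pp. 7–8 (g_A, Φ_A)] -/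
def IsStarHull.existsUnique_isRestrictionMap : Prop :=
  ∀ {A : Set ℂ}, IsStarHull A →
    ∃ Φ : ConformalEquiv (upperHalfPlaneSet \ A) upperHalfPlaneSet, IsRestrictionMap A Φ ∧
      ∀ Ψ : ConformalEquiv (upperHalfPlaneSet \ A) upperHalfPlaneSet, IsRestrictionMap A Ψ →
        EqOn Ψ Φ (upperHalfPlaneSet \ A)

/-- NAMED FACT — **`Φ'_A(0)` exists and lies in `(0, 1]`** ([LSW] (2.4), p. 7:
"`0 < g_A'(x) ≤ 1`, `x ∈ ℝ ∖ A`", applied at `x = 0 ∉ A`, where `Φ_A' = g_A'`; the derivative at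
the boundary point exists by Schwarz reflection). [cite: LawlerSchrammWerner2003Restriction, §2 (2.4) p. 7] -/
def IsStarHull.exists_hasRestrictionDeriv : Prop :=
  ∀ {A : Set ℂ}, IsStarHull A →
    ∀ {Φ : ConformalEquiv (upperHalfPlaneSet \ A) upperHalfPlaneSet}, IsRestrictionMap A Φ →
      ∃ d : ℝ, 0 < d ∧ d ≤ 1 ∧ HasRestrictionDeriv A Φ d

/-! ### [LSW] Theorem 6.1: the restriction formula for SLE_{8/3} -/

/-- NAMED FACT — **[LSW] Theorem 6.1 (Restriction).** "Let `γ` be the SLE_{8/3} path starting at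
the origin and `A ∈ 𝒬*`, then `P[γ[0, ∞) ∩ A = ∅] = Φ'_A(0)^{5/8}`." Here `γ = sleTrace (8/3) ω`
is the trace of the chordal SLE_{8/3} Loewner chain on the canonical space
`(ℝ≥0 → ℝ, preWienerMeasure)`, `γ[0, ∞) = range γ`, and `Φ'_A(0)` is any `d` with
`HasRestrictionDeriv A Φ d` for a restriction map `Φ` of `A` (unique; exists by
`IsStarHull.existsUnique_isRestrictionMap`, `IsStarHull.exists_hasRestrictionDeriv`). The second
sentence of the theorem, "The law of `γ(0, ∞)` is therefore `P_{5/8}`", needs the restriction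
measures `P_α` of Prop. 3.3 / Def. 3.4 (level 2, not vendored here); its transposition to
Dobrushin domains is `Literature.Probability.RandomPlanarGeometry.IsSLELaw.hullRestriction_eightThirds`. Proof in the paper: Prop. 5.2
(`h_t'(W_t)^{5/8}` is a bounded local martingale, an Itô–Schwarzian computation), Lemmas 6.2–6.3
(its limit is `𝟙{γ ∩ A = ∅}`), Prop. 3.3 (smooth hulls suffice).
[cite: LawlerSchrammWerner2003Restriction, Thm. 6.1 (p. 23)] -/
def sle_restriction_eightThirds : Prop :=
  ∀ {A : Set ℂ}, IsStarHull A →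
    ∀ {Φ : ConformalEquiv (upperHalfPlaneSet \ A) upperHalfPlaneSet}, IsRestrictionMap A Φ →
      ∀ {d : ℝ}, HasRestrictionDeriv A Φ d →
        Process.preWienerMeasure {ω | Disjoint (range (sleTrace ((8 : ℝ≥0) / 3) ω)) A} =
          ENNReal.ofReal (d ^ ((5 : ℝ) / 8))

/-- Sanity check of the statement at `A = ∅` (`Φ_∅ = id`, `Φ'_∅(0) = 1`): Thm. 6.1 asserts that the
pre-Wiener measure has total mass `1 = 1^{5/8}`, as it must. [folklore] -/
theorem sle_restriction_eightThirds.measure_univ (h : sle_restriction_eightThirds) :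
    Process.preWienerMeasure (univ : Set (ℝ≥0 → ℝ)) = 1 := by
  have := h isStarHull_empty isRestrictionMap_empty hasRestrictionDeriv_empty
  simpa using this

end Literature.Probability.RandomPlanarGeometry

end
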